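import Summits.Ventures.Crystal3D.Theorems.StickyWulffConstantGenericWallFloorOffReach
import Summits.Ventures.Crystal3D.Theorems.StickyWulffConstantGenericWallFloorCoreResidualTilt
import HarnessLib

/-!
# The residual of lane G after the arrival case split: REGISTERED translations only
# (crux `GenericWallFloor`, stmt-Ventures-19480, line `WallLedgerG`)

HONEST FRAMING. Venture `Summits/Ventures/Crystal3D` (cell `crystal3d-full`), helper `--supports` the crux
`GenericWallFloor` of `route-Ventures-StickyWulffConstant`, REGISTERED line `WallLedgerG`, open stub
`stub_twoSlabAdhesion`.  Bookkeeping only; F-C1 not moved; NOT the crux: `ExactOnly`(C12-55) [E1] and `StarPairFar`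
[certified] stay BY NAME and the registered residual below is OPEN.

`…OffReach` (this seat) proves the crux's matrix `GenericWallFloorAt A₁ t₁ A₂ t₂` (c₀ = 1) for EVERY pair of frames and
every relative translation OFF the registry set of some steep slot pair (disjoint reach sets).  This file re-shrinks
19480-p1 g7's residual `GenericWallFloorCoreResidualTilt` accordingly, so that the kernel debt of the lane reads
{`ExactOnly`(C12-55), `StarPairFar`, `GenericWallFloorRegisteredResidual`}:
* `RegisteredAt A₁ t₁ A₂ t₂` — for EVERY steep up-slot `u₁` of grain 1 and steep down-slot `u₂` of grain 2 the two reach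
  sets `reachSet A₁ t₁ (chainFrames e₃ A₁ u₁)`, `reachSet A₂ t₂ (chainFrames (−e₃) A₂ u₂)` MEET (the relative translation
  is registered for every forced-ray pair);
* `genericWallFloorAt_of_not_registeredAt` — unregistered pairs satisfy the matrix (`genericWallFloorAt_offReach`);
* `GenericWallFloorRegisteredResidual` — the crux's matrix on ray-aligned non-co-axial pairs outside the four priced
  one-sided `Σ9` classes (of record and tilted) AND registered; **`genericWallFloor_of_registeredResidual`**:
  `ExactOnly`(C12-55) → `StarPairFar` → `GenericWallFloorRegisteredResidual` → the route decl BY NAME; converses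
  `…_of_coreResidualTilt`, `…_of_genericWallFloor` (nothing smuggled).
WHAT THE RESIDUAL IS: per residual orientation pair, a countable family of relative translations — the exact CSL
registries in which one grain's walkers can stand on the other grain's lattice, i.e. where coherent lamellae and their
T = 0 risers (rows R-G2H, `…RiserEndRows`) exist.  WHAT THIS IS NOT: a proof of it; F-C1 not moved.
-/

noncomputable section

namespace Summit.Ventures.Crystal3D.Theorems

open Summit.Ventures.Crystal3D Finset
open Literature.MathematicalPhysics.StatisticalMechanics (fccStacking barlowStacking IsHaggSeq)
open scoped InnerProductSpace

/-- **Registered pair**: for every steep up-slot `u₁` of grain 1 and every steep down-slot `u₂` of grain 2 the reach sets of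
the two grains over their forced-ray frame sets MEET (equivalently, `t₂ − t₁` lies in every registry set
`A₁·Λ₀ − A₂·Λ₀ + reachGroup (chainFrames e₃ A₁ u₁) − reachGroup (chainFrames (−e₃) A₂ u₂)`). -/
def RegisteredAt (A₁ : EuclideanSpace ℝ (Fin 3) ≃ₗᵢ[ℝ] EuclideanSpace ℝ (Fin 3)) (t₁ : EuclideanSpace ℝ (Fin 3))
    (A₂ : EuclideanSpace ℝ (Fin 3) ≃ₗᵢ[ℝ] EuclideanSpace ℝ (Fin 3)) (t₂ : EuclideanSpace ℝ (Fin 3)) : Prop :=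
  ∀ u₁ ∈ fccSlots, Real.sqrt 2 / 2 ≤ ⟪A₁ u₁, EuclideanSpace.single (2 : Fin 3) (1 : ℝ)⟫_ℝ →
    ∀ u₂ ∈ fccSlots, ⟪A₂ u₂, EuclideanSpace.single (2 : Fin 3) (1 : ℝ)⟫_ℝ ≤ -(Real.sqrt 2 / 2) →
      ∃ y, y ∈ reachSet A₁ t₁ (chainFrames (EuclideanSpace.single (2 : Fin 3) (1 : ℝ)) A₁ u₁) ∧
        y ∈ reachSet A₂ t₂ (chainFrames (-EuclideanSpace.single (2 : Fin 3) (1 : ℝ)) A₂ u₂)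

open scoped Classical in
/-- **Unregistered pairs satisfy the crux's matrix** (c₀ = 1), modulo `ExactOnly`(C12-55) and `StarPairFar`. -/
theorem genericWallFloorAt_of_not_registeredAt
    {s₀ : EuclideanSpace ℝ (Fin 3)} (hs₀ : s₀ ∈ fccSlots)
    (hcert : ExactOnly 0 (fccSlots.filter fun w => 0 < ⟪w, s₀⟫_ℝ)) (hfar : StarPairFar)
    {A₁ : EuclideanSpace ℝ (Fin 3) ≃ₗᵢ[ℝ] EuclideanSpace ℝ (Fin 3)} {t₁ : EuclideanSpace ℝ (Fin 3)}
    {A₂ : EuclideanSpace ℝ (Fin 3) ≃ₗᵢ[ℝ] EuclideanSpace ℝ (Fin 3)} {t₂ : EuclideanSpace ℝ (Fin 3)}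
    (h : ¬ RegisteredAt A₁ t₁ A₂ t₂) : GenericWallFloorAt A₁ t₁ A₂ t₂ := by
  unfold RegisteredAt at h
  push Not at h
  obtain ⟨u₁, hu₁, hsteep₁, u₂, hu₂, hsteep₂, hdisj⟩ := h
  exact genericWallFloorAt_offReach hs₀ hcert hfar A₁ t₁ A₂ t₂ hu₁ hsteep₁ hu₂ hsteep₂ _ _
    (fun _ hS hW hlast => frame_mem_chainFrames_of_stack hS hW hlast)
    (fun _ hS hW hlast => frame_mem_chainFrames_of_stack hS hW hlast)
    (fun y hy₁ hy₂ => hdisj y hy₁ hy₂)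

/-- **The REGISTERED residual of lane G**: the crux's matrix on every ray-aligned non-co-axial pair outside the four priced
one-sided `Σ9` classes that is moreover REGISTERED. -/
def GenericWallFloorRegisteredResidual : Prop :=
  ∀ (A₁ : EuclideanSpace ℝ (Fin 3) ≃ₗᵢ[ℝ] EuclideanSpace ℝ (Fin 3)) (t₁ : EuclideanSpace ℝ (Fin 3))
    (A₂ : EuclideanSpace ℝ (Fin 3) ≃ₗᵢ[ℝ] EuclideanSpace ℝ (Fin 3)) (t₂ : EuclideanSpace ℝ (Fin 3)),
    ¬ (∃ (L : EuclideanSpace ℝ (Fin 3) ≃ₗᵢ[ℝ] EuclideanSpace ℝ (Fin 3)) (s₁ s₂ : EuclideanSpace ℝ (Fin 3))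
        (σ σ' : ℤ → ℤ), IsHaggSeq σ ∧ IsHaggSeq σ' ∧
        (fun p => A₁ p + t₁) '' fccStacking 1 (Real.sqrt (2 / 3)) ⊆
          (fun p => L p + s₁) '' barlowStacking 1 (Real.sqrt (2 / 3)) σ ∧
        (fun p => A₂ p + t₂) '' fccStacking 1 (Real.sqrt (2 / 3)) ⊆
          (fun p => L p + s₂) '' barlowStacking 1 (Real.sqrt (2 / 3)) σ') →
    RayAlignedAt A₁ A₂ → ¬ Sigma9OneSidedAt A₁ A₂ → ¬ Sigma9OneSidedDownAt A₁ A₂ →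
    ¬ Sigma9TiltAt A₁ A₂ → ¬ Sigma9TiltDownAt A₁ A₂ → RegisteredAt A₁ t₁ A₂ t₂ → GenericWallFloorAt A₁ t₁ A₂ t₂

/-- **The crux BY NAME from `ExactOnly`(C12-55), `StarPairFar` and the REGISTERED residual.** -/
theorem genericWallFloor_of_registeredResidual
    {s₀ : EuclideanSpace ℝ (Fin 3)} (hs₀ : s₀ ∈ fccSlots)
    (hcert : ExactOnly 0 (fccSlots.filter fun w => 0 < ⟪w, s₀⟫_ℝ)) (hfar : StarPairFar)
    (hres : GenericWallFloorRegisteredResidual) :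
    Summit.Ventures.Crystal3D.Theses.StickyWulffConstant.GenericWallFloor := by
  refine genericWallFloor_of_coreResidualTilt hs₀ hcert hfar fun A₁ t₁ A₂ t₂ hnc hra h₁ h₂ h₃ h₄ => ?_
  by_cases hreg : RegisteredAt A₁ t₁ A₂ t₂
  · exact hres A₁ t₁ A₂ t₂ hnc hra h₁ h₂ h₃ h₄ hreg
  · exact genericWallFloorAt_of_not_registeredAt hs₀ hcert hfar hreg

/-- The registered residual is implied by the tilted one (hence by the crux): nothing is smuggled. -/
theorem genericWallFloorRegisteredResidual_of_coreResidualTilt (h : GenericWallFloorCoreResidualTilt) :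
    GenericWallFloorRegisteredResidual :=
  fun A₁ t₁ A₂ t₂ hnc hra h₁ h₂ h₃ h₄ _ => h A₁ t₁ A₂ t₂ hnc hra h₁ h₂ h₃ h₄

/-- The crux implies the registered residual. -/
theorem genericWallFloorRegisteredResidual_of_genericWallFloor
    (h : Summit.Ventures.Crystal3D.Theses.StickyWulffConstant.GenericWallFloor) : GenericWallFloorRegisteredResidual :=
  genericWallFloorRegisteredResidual_of_coreResidualTilt (genericWallFloorCoreResidualTilt_of_genericWallFloor h)

end Summit.Ventures.Crystal3D.Theorems

end
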